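import Summits.QuantumFields.YangMills.Theorems.BalabanUVNodesN18KingModelRecordWindow
import Summits.QuantumFields.YangMills.Theorems.BalabanUVNodesN18KingModelVertexU3
import Summits.QuantumFields.YangMills.Theorems.BalabanUVNodesN22AtRateRecord13Fixed

/-!
# BalabanUVNodes ∕ N18 — KING's MODEL WITH LIPSCHITZ VERTEX FUNCTIONS AT THE RECORD's WINDOW: the LIVE-BRACKET U3 rung
# (`…N18KingModelVertexU3.u3Rung_kingModel_vertex_torus`) and its DRESSED bundle (`…n18At_dressed_kingModel_vertex_torus`) read in the
# Stage-13 bundle-of-record shape `u3OfRecord₁₃ θ (U3Objects₁₁.ofFixed …) k` — the N18 slot AND the N22 slot WITH LIVE HISTORY MODULI OF RECORD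
# `2C₉A·ω^{k−i}` (`A ≥ 0` the rung's amplitude; not forced to vanish), at every Stage-13 tuple and run length, and the ₁₃-`CoPH` home (Track A, DAG node N18 = NE5; width seat
# `pub-ymgap-dag-n10-w2` REBALANCED to n18 by plan g79 № 9; dag-n18-w3's untaken successor (C) of `…N18KingModelRecordWindow` p583713)

HONEST FRAMING.  Count-neutral kernel bookkeeping BY NAME (`--kind proof --supports stmt-QuantumFields-20544 --as helper`, K3⁷
`SpineGivenEndpointR13SepCoPH`): BC5-type SATISFIABILITY faces of the N18 ∕ N22 slot SHAPES of the ₁₃ bundle of record by King's `A = 0` operators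
with abstract bounded ∕ Lipschitz VERTEX insertions (dag-n18-e modules 6b ∕ 8) — NOT Bałaban's covariant outputs `E^{(j)}(X; g, U_k(V))` of
[Balaban1987RG1] (0.24) ∕ (2.13) (NE5 ∕ NE9 are NOT IN PRINT for them and have no tree producer; NODE O instance 0 ∕ 1), NOT node00-def-W1's
`functionalC`; the vertex moduli `ℓ, Λ, C₉, ω` are DATA; N17 ∕ (D4) NOT modelled (run B's family is constant in its first coupling); N18 ∕ N22 NOT
discharged; K3⁷ OPEN, not claimed; counts UNMOVED (typed 28∕28 · discharged 5∕27, A 5∕28).  One finite four-torus programme at fixed `ε`, Bałaban AS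
PRINTED; R4 closes the conditional finite-𝕋⁴ rung `BalabanLadder.UV` only — NOT ℝ⁴, NOT infinite volume, NOT OS, NOT a mass gap, NOT Clay.
THEOREMS ONLY: 0 `def`, 0 `sorry`, standard axioms.  v1.0.1 (docstring-only, declarations byte-identical): «NON-ZERO moduli» → «LIVE moduli,
`A ≥ 0`» at three places, folding ref-N g2 READ-17's NIT (the rung yields `0 ≤ A` only).

WHY.  dag-n18-w3's `…N18KingModelRecordWindow` (p583713) reads King's COUPLING-BLIND three-factor model in the ₁₃ bundle: `N18At` at every tuple ∕ run
length (`n18At_kingModel_u3OfRecord₁₃`) and an N22 face whose NE9 VANISHES (`n22At_kingModel_u3OfRecord₁₃`: run A reads neither `g` nor `U`).  Its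
HANDOFF left (C) «the DRESSED record-bundle twin of §3 over `n18At_dressed_kingModel_vertex_torus`» untaken.  dag-n18-e's vertex lineage (modules
6b ∕ 8) is the model in which the HISTORY bracket is LIVE: with vertex functions `h, k` `Λ`-Lipschitz in the coupling history under `FadingMemory C₉ ω Λ`
the bundle carries `N22At` with moduli `2Λ·A` and fading constant `2C₉·A`.  THIS FILE reads both in the bundle-of-record shape:
* §1 ★ `n18At_n22At_kingModel_vertex_u3OfRecord₁₃` — for `d ≥ 1`, odd `L > 1`, `a, m² > 0`, `0 < γ ≤ 1`: `∃ κ > 0, A ≥ 0, C₅ ≥ 0` (of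
  `d, L, a, m², γ` only; `u3Rung_kingModel_vertex_torus`) such that on module 8's binder list, at EVERY Stage-13 tuple `θ` (window `]0, θ.γ]`), for
  vertex moduli `ℓ ≥ 0`, `Λ ≥ 0` with `FadingMemory C₉ ω Λ` read ON THE RECORD's WINDOW, and letters `0 ≤ ω ≤ ρ`, `L^{−γ∕2} ≤ ρ < 1`, `0 ≤ cr`, `0 ≤ C₉`:
  `N18At (u3OfRecord₁₃ θ (ofFixed C EA (fun _ ↦ EB) ⟨κ, L^{−γ∕2}, C₅, 2C₉A, ω, cr, ρ⟩) k) ∧ N22At (same)` at EVERY run length `k` — the N22 slot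
  with the LIVE moduli of record `2C₉A·ω^{k−i}` (`A ≥ 0` as the rung yields it; positive exactly when module 6b's amplitude `A` and `C₉` are — no
  theorem here asserts `0 < A`; p583713's N22 face is the one whose NE9 VANISHES) (by `n18At_u3OfRecord₁₃_ofFixed_of_n18At` and dag-n22-e's
  `YMDAG.N22.n22At_u3OfRecord₁₃_ofFixed_of_ne9_fading`, the letter signs by p583713's `kingModel_letters_signs`);
* §2 ★ `n18At_dressed_kingModel_vertex_u3OfRecord₁₃` — (C) verbatim: the DRESSED bundle (carriers `Dom ⊕ Dom × T`, run A `Sum.elim E_A D_A`, run B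
  `Sum.elim E_B D_B`, a `t`-indexed family of vertex functions for the dressed pieces) of `n18At_dressed_kingModel_vertex_torus` gives the N18 slot of
  the ₁₃ bundle of its fixed objects at EVERY tuple and run length (`n18At_u3OfRecord₁₃_ofFixed_of_forall_window`: the rung holds on every window);
* §3 `s_N18_rRec₁₃CoPH_dressed_kingModel_vertex` — the ₁₃-`CoPH` home in pin form: every Stage-13 `CoPH` reading whose U3 objects ARE such a dressed
  fixed bundle at every admissible tuple satisfies `S_N18 (RRec₁₃CoPH 𝔯)` (`s_N18_rRec₁₃CoPH_of_ofFixed`; mirror of `s_N18_rRec₁₃CoPH_kingModel`).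
READING (for the K3⁷ v2 guard discussion, nothing new claimed): a vertex-King END whose vertex functions read `g` is a candidate inhabitant of
dag-n18-w2's functional-level guard `SensitiveOnBoxes` as well; that such guards are met by MODELS carrying `N18At ∧ N22At` (indeed `∧ ReadOutAt`) is
already kernel in dag-n17-w2's `…N17D4ReadOutGuardShadow` (p586417, the β-encoding shadow) — not re-done here; only the (D4) tie ∕ the W1 pin bind a
reading to Bałaban's outputs.

Sources (TYPES and the model only): C. King, Commun. Math. Phys. **102** (1986) 649–677 [King1986] — Prop. 3.9 (3.73) p. 665, (4.42)–(4.43)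
p. 675; T. Bałaban, Commun. Math. Phys. **109** (1987) 249–301 [Balaban1987RG1] — (0.24)–(0.25) p. 257, Thm 1 p. 259 («contained in an interval
]0, γ]»: the window), (1.18)–(1.22) pp. 263–264, §5 p. 298; **119** (1988) 243–285 [Balaban1988Convergent] (2.27)(ii)–(2.28) p. 259; **116** (1988)
1–22 [Balaban1988RG2Cluster] (2.13)–(2.14) pp. 14–15.  No claim about the mass gap.
-/

noncomputable section

namespace Summit.QuantumFields.YangMills.BalabanUVNodes.N18KingModelVertexRecordWindow

open Real Matrix
open Literature.MathematicalPhysics.QuantumFieldTheory.Balaban1983to89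
open Literature.MathematicalPhysics.QuantumFieldTheory.Balaban1983to89.T4Continuum (T4Family ULoop)
open Literature.MathematicalPhysics.QuantumFieldTheory.Balaban1983to89.T4OutputRate
  (Carriers Functional NE5 NE9 FadingMemory Window LipBackground)
open Literature.MathematicalPhysics.QuantumFieldTheory.Balaban1983to89.B5Prop11Plancherel (Tor fine)
open Literature.MathematicalPhysics.QuantumFieldTheory.King1986 (aK)
open Literature.MathematicalPhysics.QuantumFieldTheory.King1986.Torus (minimiser effLaplacian blockProj blockOf tdistT)
open Node00 (Stage13Params Stage13HParams U3Letters₁₁ U3Objects₁₁)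
open Summit.QuantumFields.YangMills.BalabanUVNodes.N18KingModel (kingTheta_pos)
open Summit.QuantumFields.YangMills.BalabanUVNodes.N18KingModelVertexU3 (u3Rung_kingModel_vertex_torus n18At_dressed_kingModel_vertex_torus)
open Summit.QuantumFields.YangMills.BalabanUVNodes.N18KingModelRecordWindow
  (n18At_u3OfRecord₁₃_ofFixed_of_n18At n18At_u3OfRecord₁₃_ofFixed_of_forall_window s_N18_rRec₁₃CoPH_of_ofFixed kingModel_letters_signs)
open YMDAG.UVSplit

variable {d : ℕ}

/-! ## §1 The live-bracket vertex rung in the ₁₃ bundle of record: N18 AND N22 with live history moduli (`A ≥ 0`) -/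

/-- ★ **KING's (4.42) GRAPHS WITH LIPSCHITZ VERTEX FUNCTIONS INHABIT THE N18 AND THE N22 SLOT OF THE ₁₃ BUNDLE — the N22 slot with LIVE
HISTORY MODULI OF RECORD** (`2C₉A·ω^{k−i}` with the rung's amplitude `A ≥ 0`; no positivity of `A` is asserted).  For `d ≥ 1`, odd `L > 1`, `a > 0`, `m² > 0`, `0 < γ ≤ 1` there are `κ > 0`, `A ≥ 0`, `C₅ ≥ 0` (functions of
`d, L, a, m², γ` ONLY — the letters of `…N18KingModelVertexU3.u3Rung_kingModel_vertex_torus`, BY NAME) such that on module 8's binder list (`n ≥ 1`,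
Bałaban unit tori `L·M_j(μ) = 2L^{m_j}`, carriers with creation scales `≥ 1` reading run A's fine points under run B's, King's vertex-decorated graphs
`EA`, `EB` with vertex functions `h, k` bounded by one), at EVERY Stage-13 tuple `θ`, for a gauge modulus `ℓ ≥ 0` and history moduli `Λ ≥ 0` with
`FadingMemory C₉ ω Λ` (`h, k` `Λ`-Lipschitz in the history ON THE RECORD's WINDOW `]0, θ.γ]`), `0 ≤ C₉`, and read-out letters `0 ≤ ω ≤ ρ`,
`L^{−γ∕2} ≤ ρ < 1`, `0 ≤ cr`: at EVERY run length `k`,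
`N18At (u3OfRecord₁₃ θ (ofFixed C EA (fun _ ↦ EB) ⟨κ, L^{−γ∕2}, C₅, 2C₉A, ω, cr, ρ⟩) k) ∧ N22At (same bundle)` — NE9 with the moduli of record
`2C₉A·ω^{k−i}` DOMINATING the live table `2Λ·A`, fading memory the block's shape.  `A = 0` operators with abstract insertions; NOT Bałaban's outputs.
[cite: King1986, Prop. 3.9 (3.73) p.665, (4.42)–(4.43) p.675; Balaban1987RG1, Thm 1 p.259, (1.18) p.263, §5 p.298] -/
theorem n18At_n22At_kingModel_vertex_u3OfRecord₁₃ (hd : 1 ≤ d) (L : ℕ) [NeZero L] (hLp : Odd L ∧ 1 < L) {a m2 : ℝ}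
    (ha : 0 < a) (hm : 0 < m2) {γ : ℝ} (hγ0 : 0 < γ) (hγ1 : γ ≤ 1) :
    ∃ κ A C₅ : ℝ, 0 < κ ∧ 0 ≤ A ∧ 0 ≤ C₅ ∧
      ∀ (n : ℕ) (_hn : 1 ≤ n) (M : ℕ → Fin d → ℕ) [∀ j μ, NeZero (M j μ)]
        (_hM : ∀ j, ∃ mm : ℕ, ∀ μ, L * M j μ = 2 * L ^ mm)
        (C : Carriers) (_hsc : ∀ X, 1 ≤ C.scale X)
        (xA yA : (X : C.Dom) → Tor (fine (L ^ C.scale X) (fine L (M (C.scale X)))))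
        (xB yB : (X : C.Dom) → Tor (fine (L ^ n * L ^ C.scale X) (fine L (M (C.scale X)))))
        (_hx : ∀ X μ, (xA X μ).val = (xB X μ).val / L ^ n)
        (_hy : ∀ X μ, (yA X μ).val = (yB X μ).val / L ^ n)
        (_hd : ∀ X, C.d X ≤ tdistT (fine L (M (C.scale X)))
            (blockOf (L ^ C.scale X) (fine L (M (C.scale X))) (xA X))
            (blockOf (L ^ C.scale X) (fine L (M (C.scale X))) (yA X)))
        (h k : (X : C.Dom) → (ℕ → ℝ) → C.BgA → Tor (fine L (M (C.scale X))) → ℝ)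
        (_hh : ∀ X g U z, |h X g U z| ≤ 1) (_hk : ∀ X g U w, |k X g U w| ≤ 1)
        (EA : Functional C C.BgA) (EB : Functional C C.BgB)
        (_hEA : ∀ g U X, EA g U X =
          (fun z => minimiser (L ^ C.scale X) (fine L (M (C.scale X))) (aK a L (C.scale X))
              (((L ^ C.scale X : ℕ) : ℝ) ^ 2) m2 (Pi.single z 1) (xA X) * h X g U z)
            ⬝ᵥ ((effLaplacian (L ^ C.scale X) (fine L (M (C.scale X))) (aK a L (C.scale X))
                    (((L ^ C.scale X : ℕ) : ℝ) ^ 2) m2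
                  + (a * ((L : ℝ) ^ 2)⁻¹) • blockProj L (M (C.scale X)))⁻¹
                *ᵥ fun w => k X g U w * minimiser (L ^ C.scale X) (fine L (M (C.scale X))) (aK a L (C.scale X))
                    (((L ^ C.scale X : ℕ) : ℝ) ^ 2) m2 (Pi.single w 1) (yA X)))
        (_hEB : ∀ g U X, EB g U X =
          (fun z => minimiser (L ^ n * L ^ C.scale X) (fine L (M (C.scale X))) (aK a L (C.scale X + n))
              (((L ^ n * L ^ C.scale X : ℕ) : ℝ) ^ 2) m2 (Pi.single z 1) (xB X) * h X g (C.transport U) z)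
            ⬝ᵥ ((effLaplacian (L ^ n * L ^ C.scale X) (fine L (M (C.scale X))) (aK a L (C.scale X + n))
                    (((L ^ n * L ^ C.scale X : ℕ) : ℝ) ^ 2) m2
                  + (a * ((L : ℝ) ^ 2)⁻¹) • blockProj L (M (C.scale X)))⁻¹
                *ᵥ fun w => k X g (C.transport U) w * minimiser (L ^ n * L ^ C.scale X) (fine L (M (C.scale X)))
                    (aK a L (C.scale X + n)) (((L ^ n * L ^ C.scale X : ℕ) : ℝ) ^ 2) m2 (Pi.single w 1) (yB X)))
        {N : ℕ} [NeZero N] {F : T4Family} (θ : Stage13Params F N)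
        {ℓ : ℝ} (_hℓ : 0 ≤ ℓ)
        (_hhℓ : ∀ X g (U U' : C.BgA) z, |h X g U z - h X g U' z| ≤ ℓ * C.gauge U U')
        (_hkℓ : ∀ X g (U U' : C.BgA) w, |k X g U w - k X g U' w| ≤ ℓ * C.gauge U U')
        {Λ : ℕ → ℕ → ℝ} {C₉ ω : ℝ} (_hΛ0 : ∀ j i, 0 ≤ Λ j i) (_hΛ : FadingMemory C₉ ω Λ)
        (_hhΛ : ∀ X, ∀ g ∈ Window θ.γ, ∀ g' ∈ Window θ.γ, ∀ (U : C.BgA) z,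
          |h X g U z - h X g' U z| ≤ ∑ i ∈ Finset.range (C.scale X), Λ (C.scale X) i * |g i - g' i|)
        (_hkΛ : ∀ X, ∀ g ∈ Window θ.γ, ∀ g' ∈ Window θ.γ, ∀ (U : C.BgA) w,
          |k X g U w - k X g' U w| ≤ ∑ i ∈ Finset.range (C.scale X), Λ (C.scale X) i * |g i - g' i|)
        (_hC₉ : 0 ≤ C₉) {cr ρ : ℝ} (_hω0 : 0 ≤ ω) (_hcr : 0 ≤ cr) (_hθρ : (L : ℝ) ^ (-(γ / 2)) ≤ ρ) (_hωρ : ω ≤ ρ)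
        (_hρ : ρ < 1) (k' : ℕ),
        N18At (u3OfRecord₁₃ θ
          (U3Objects₁₁.ofFixed C EA (fun _ => EB) ⟨κ, (L : ℝ) ^ (-(γ / 2)), C₅, 2 * C₉ * A, ω, cr, ρ⟩) k') ∧
        N22At (u3OfRecord₁₃ θ
          (U3Objects₁₁.ofFixed C EA (fun _ => EB) ⟨κ, (L : ℝ) ^ (-(γ / 2)), C₅, 2 * C₉ * A, ω, cr, ρ⟩) k') := by
  obtain ⟨κ, A, C₅, hκ, hA, hC₅, H⟩ := u3Rung_kingModel_vertex_torus hd L hLp ha hm hγ0.le hγ1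
  refine ⟨κ, A, C₅, hκ, hA, hC₅, ?_⟩
  intro n hn M _ hM C hsc xA yA xB yB hx hy hdd h k hh hk EA EB hEA hEB N _ F θ ℓ hℓ hhℓ hkℓ Λ C₉ ω hΛ0 hΛ hhΛ hkΛ hC₉ cr ρ hω0
    hcr hθρ hωρ hρ k'
  -- the live-bracket rung at the window `]0, θ.γ]`, radius `θ.γ`
  obtain ⟨h18, h22, -, -, -⟩ := H n hn M hM C hsc xA yA xB yB hx hy hdd h k hh hk EA EB hEA hEB (Window θ.γ) hℓ hhℓ hkℓ hΛ0 hΛ hhΛ hkΛ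
    θ.γ cr ρ
  have hθ0 : 0 ≤ (L : ℝ) ^ (-(γ / 2)) := (kingTheta_pos (by have := hLp.2; omega) _).le
  have hL2 : 2 ≤ L := hLp.2
  have hs : (⟨κ, (L : ℝ) ^ (-(γ / 2)), C₅, 2 * C₉ * A, ω, cr, ρ⟩ : U3Letters₁₁).Signs :=
    kingModel_letters_signs hL2 hγ0 hκ hC₅ (by positivity) hω0 hcr hθρ hωρ hρ
  refine ⟨?_, ?_⟩
  · exact n18At_u3OfRecord₁₃_ofFixed_of_n18At (ℓ := ⟨κ, (L : ℝ) ^ (-(γ / 2)), C₅, 2 * C₉ * A, ω, cr, ρ⟩) k' h18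
      subset_rfl le_rfl le_rfl hθ0 le_rfl hC₅ le_rfl
  · exact YMDAG.N22.n22At_u3OfRecord₁₃_ofFixed_of_ne9_fading θ C EA (fun _ => EB)
      ⟨κ, (L : ℝ) ^ (-(γ / 2)), C₅, 2 * C₉ * A, ω, cr, ρ⟩ k' hs h22.1 h22.2 le_rfl rfl

/-! ## §2 (C): the DRESSED vertex bundle at the record's window -/

/-- ★ **THE DRESSED VERTEX-KING BUNDLE INHABITS THE N18 SLOT OF THE ₁₃ BUNDLE AT EVERY STAGE-13 TUPLE AND RUN LENGTH** (dag-n18-w3's untaken (C)).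
For `d ≥ 1`, odd `L > 1`, `a > 0`, `m² > 0`, `0 ≤ γ ≤ 1` there are `κ > 0`, `C₅ ≥ 0` (of `d, L, a, m², γ` only — the letters of
`n18At_dressed_kingModel_vertex_torus`) such that on module 8 §2's binder list (vacuum insertions `h, k`, a `t`-indexed family `h_t, k_t` for the dressed
pieces, all bounded by one; King's graphs `EA, EB`, `DA t, DB t`), for EVERY Stage-13 tuple `θ`, run length `k`, and remaining letters `C₉, ω, cr, ρ`:
`N18At (u3OfRecord₁₃ θ (ofFixed C⁺ (Sum.elim E_A D_A) (fun _ ↦ Sum.elim E_B D_B) ⟨κ, L^{−γ∕2}, C₅, C₉, ω, cr, ρ⟩) k)` with the dressed carriers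
`C⁺ = {C with Dom := Dom ⊕ Dom × T, …}` — the rung holds on EVERY window, so `n18At_u3OfRecord₁₃_ofFixed_of_forall_window` places it; uniformity in the
source `t` is automatic in the model (module 8's point).  NOT Bałaban's dressed outputs.
[cite: Balaban1988Convergent, (2.27) p.259; King1986, Prop. 3.9 (3.73) p.665; Balaban1987RG1, Thm 1 p.259] -/
theorem n18At_dressed_kingModel_vertex_u3OfRecord₁₃ (hd : 1 ≤ d) (L : ℕ) [NeZero L] (hLp : Odd L ∧ 1 < L) {a m2 : ℝ}
    (ha : 0 < a) (hm : 0 < m2) {γ : ℝ} (hγ0 : 0 ≤ γ) (hγ1 : γ ≤ 1) :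
    ∃ κ C₅ : ℝ, 0 < κ ∧ 0 ≤ C₅ ∧
      ∀ (n : ℕ) (_hn : 1 ≤ n) (M : ℕ → Fin d → ℕ) [∀ j μ, NeZero (M j μ)]
        (_hM : ∀ j, ∃ mm : ℕ, ∀ μ, L * M j μ = 2 * L ^ mm)
        (C : Carriers) (_hsc : ∀ X, 1 ≤ C.scale X)
        (xA yA : (X : C.Dom) → Tor (fine (L ^ C.scale X) (fine L (M (C.scale X)))))
        (xB yB : (X : C.Dom) → Tor (fine (L ^ n * L ^ C.scale X) (fine L (M (C.scale X)))))
        (_hx : ∀ X μ, (xA X μ).val = (xB X μ).val / L ^ n)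
        (_hy : ∀ X μ, (yA X μ).val = (yB X μ).val / L ^ n)
        (_hd : ∀ X, C.d X ≤ tdistT (fine L (M (C.scale X)))
            (blockOf (L ^ C.scale X) (fine L (M (C.scale X))) (xA X))
            (blockOf (L ^ C.scale X) (fine L (M (C.scale X))) (yA X)))
        {T : Type}
        (h k : (X : C.Dom) → (ℕ → ℝ) → C.BgA → Tor (fine L (M (C.scale X))) → ℝ)
        (hT kT : T → (X : C.Dom) → (ℕ → ℝ) → C.BgA → Tor (fine L (M (C.scale X))) → ℝ)
        (_hh : ∀ X g U z, |h X g U z| ≤ 1) (_hk : ∀ X g U w, |k X g U w| ≤ 1)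
        (_hhT : ∀ t X g U z, |hT t X g U z| ≤ 1) (_hkT : ∀ t X g U w, |kT t X g U w| ≤ 1)
        (EA : Functional C C.BgA) (EB : Functional C C.BgB) (DA : T → Functional C C.BgA) (DB : T → Functional C C.BgB)
        (_hEA : ∀ g U X, EA g U X =
          (fun z => minimiser (L ^ C.scale X) (fine L (M (C.scale X))) (aK a L (C.scale X))
              (((L ^ C.scale X : ℕ) : ℝ) ^ 2) m2 (Pi.single z 1) (xA X) * h X g U z)
            ⬝ᵥ ((effLaplacian (L ^ C.scale X) (fine L (M (C.scale X))) (aK a L (C.scale X))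
                    (((L ^ C.scale X : ℕ) : ℝ) ^ 2) m2
                  + (a * ((L : ℝ) ^ 2)⁻¹) • blockProj L (M (C.scale X)))⁻¹
                *ᵥ fun w => k X g U w * minimiser (L ^ C.scale X) (fine L (M (C.scale X))) (aK a L (C.scale X))
                    (((L ^ C.scale X : ℕ) : ℝ) ^ 2) m2 (Pi.single w 1) (yA X)))
        (_hEB : ∀ g U X, EB g U X =
          (fun z => minimiser (L ^ n * L ^ C.scale X) (fine L (M (C.scale X))) (aK a L (C.scale X + n))
              (((L ^ n * L ^ C.scale X : ℕ) : ℝ) ^ 2) m2 (Pi.single z 1) (xB X) * h X g (C.transport U) z)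
            ⬝ᵥ ((effLaplacian (L ^ n * L ^ C.scale X) (fine L (M (C.scale X))) (aK a L (C.scale X + n))
                    (((L ^ n * L ^ C.scale X : ℕ) : ℝ) ^ 2) m2
                  + (a * ((L : ℝ) ^ 2)⁻¹) • blockProj L (M (C.scale X)))⁻¹
                *ᵥ fun w => k X g (C.transport U) w * minimiser (L ^ n * L ^ C.scale X) (fine L (M (C.scale X)))
                    (aK a L (C.scale X + n)) (((L ^ n * L ^ C.scale X : ℕ) : ℝ) ^ 2) m2 (Pi.single w 1) (yB X)))
        (_hDA : ∀ t g U X, DA t g U X =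
          (fun z => minimiser (L ^ C.scale X) (fine L (M (C.scale X))) (aK a L (C.scale X))
              (((L ^ C.scale X : ℕ) : ℝ) ^ 2) m2 (Pi.single z 1) (xA X) * hT t X g U z)
            ⬝ᵥ ((effLaplacian (L ^ C.scale X) (fine L (M (C.scale X))) (aK a L (C.scale X))
                    (((L ^ C.scale X : ℕ) : ℝ) ^ 2) m2
                  + (a * ((L : ℝ) ^ 2)⁻¹) • blockProj L (M (C.scale X)))⁻¹
                *ᵥ fun w => kT t X g U w * minimiser (L ^ C.scale X) (fine L (M (C.scale X))) (aK a L (C.scale X))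
                    (((L ^ C.scale X : ℕ) : ℝ) ^ 2) m2 (Pi.single w 1) (yA X)))
        (_hDB : ∀ t g U X, DB t g U X =
          (fun z => minimiser (L ^ n * L ^ C.scale X) (fine L (M (C.scale X))) (aK a L (C.scale X + n))
              (((L ^ n * L ^ C.scale X : ℕ) : ℝ) ^ 2) m2 (Pi.single z 1) (xB X) * hT t X g (C.transport U) z)
            ⬝ᵥ ((effLaplacian (L ^ n * L ^ C.scale X) (fine L (M (C.scale X))) (aK a L (C.scale X + n))
                    (((L ^ n * L ^ C.scale X : ℕ) : ℝ) ^ 2) m2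
                  + (a * ((L : ℝ) ^ 2)⁻¹) • blockProj L (M (C.scale X)))⁻¹
                *ᵥ fun w => kT t X g (C.transport U) w * minimiser (L ^ n * L ^ C.scale X) (fine L (M (C.scale X)))
                    (aK a L (C.scale X + n)) (((L ^ n * L ^ C.scale X : ℕ) : ℝ) ^ 2) m2 (Pi.single w 1) (yB X)))
        {N : ℕ} [NeZero N] {F : T4Family} (θ : Stage13Params F N) (k' : ℕ) (C₉ ω cr ρ : ℝ),
        N18At (u3OfRecord₁₃ θ
          (U3Objects₁₁.ofFixed
            { C with
              Dom := C.Dom ⊕ (C.Dom × T)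
              scale := Sum.elim C.scale fun p => C.scale p.1
              d := Sum.elim C.d fun p => C.d p.1
              d_nonneg := Sum.rec (fun X => C.d_nonneg X) fun p => C.d_nonneg p.1 }
            (fun g U X => Sum.elim (EA g U) (fun p => DA p.2 g U p.1) X)
            (fun (_ : ℝ) g U X => Sum.elim (EB g U) (fun p => DB p.2 g U p.1) X)
            ⟨κ, (L : ℝ) ^ (-(γ / 2)), C₅, C₉, ω, cr, ρ⟩) k') := by
  obtain ⟨κ, C₅, hκ, hC₅, H⟩ := n18At_dressed_kingModel_vertex_torus hd L hLp ha hm hγ0 hγ1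
  refine ⟨κ, C₅, hκ, hC₅, ?_⟩
  intro n hn M _ hM C hsc xA yA xB yB hx hy hdd T h k hT kT hh hk hhT hkT EA EB DA DB hEA hEB hDA hDB N _ F θ k' C₉ ω cr ρ
  refine n18At_u3OfRecord₁₃_ofFixed_of_forall_window
    (ℓ := ⟨κ, (L : ℝ) ^ (-(γ / 2)), C₅, C₉, ω, cr, ρ⟩) (fun W b hb => ?_) θ k'
  -- the dressed rung on the window `W` with radius `b` gives its member `b`
  exact H n hn M hM C hsc xA yA xB yB hx hy hdd h k hT kT hh hk hhT hkT EA EB DA DB hEA hEB hDA hDB W b (fun _ _ => 0) C₉ ω cr ρ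
    b hb le_rfl

/-! ## §3 The ₁₃-`CoPH` home in pin form for the dressed vertex bundle -/

/-- **THE ₁₃-`CoPH` HOME FOR A READING PINNED TO THE DRESSED VERTEX-KING OBJECTS** (mirror of p583713's `s_N18_rRec₁₃CoPH_kingModel`): with the letters
`κ, C₅` of §2, EVERY Stage-13 `CoPH` reading `𝔯` whose U3 objects at every admissible tuple with provisos and every `(g₀, os)` ARE the dressed fixed bundle
of SOME instance of module 8 §2's data (unit tori, carriers, fine points, vertex families, King's graphs) with letters `⟨κ, L^{−γ∕2}, C₅, C₉, ω, cr, ρ⟩`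
satisfies `S_N18 (RRec₁₃CoPH 𝔯)` (`s_N18_rRec₁₃CoPH_of_ofFixed`: NE5 on the record's window, member by member).  NOT Bałaban's dressed outputs.
[cite: Balaban1988Convergent, (2.27) p.259; King1986, Prop. 3.9 (3.73) p.665; Balaban1987RG1, Thm 1 p.259, (1.18) p.263] -/
theorem s_N18_rRec₁₃CoPH_dressed_kingModel_vertex (hd : 1 ≤ d) (L : ℕ) [NeZero L] (hLp : Odd L ∧ 1 < L) {a m2 : ℝ}
    (ha : 0 < a) (hm : 0 < m2) {γ : ℝ} (hγ0 : 0 ≤ γ) (hγ1 : γ ≤ 1) :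
    ∃ κ C₅ : ℝ, 0 < κ ∧ 0 ≤ C₅ ∧
      ∀ {N : ℕ} [NeZero N] (𝔯 : RateReading₁₃CoPH N),
        (∀ (F : T4Family) (θ : Stage13HParams F N) (hP : θ.Provisos₁₃CoPH F N), θ.Admissible F N →
          ∀ (g₀ : ℕ → ℝ) (os : List (ULoop F)),
          ∃ (n : ℕ) (_hn : 1 ≤ n) (M : ℕ → Fin d → ℕ) (_hMz : ∀ j μ, NeZero (M j μ))
            (_hM : ∀ j, ∃ mm : ℕ, ∀ μ, L * M j μ = 2 * L ^ mm)
            (C : Carriers) (_hsc : ∀ X, 1 ≤ C.scale X)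
            (xA yA : (X : C.Dom) → Tor (fine (L ^ C.scale X) (fine L (M (C.scale X)))))
            (xB yB : (X : C.Dom) → Tor (fine (L ^ n * L ^ C.scale X) (fine L (M (C.scale X)))))
            (_hx : ∀ X μ, (xA X μ).val = (xB X μ).val / L ^ n)
            (_hy : ∀ X μ, (yA X μ).val = (yB X μ).val / L ^ n)
            (_hd : ∀ X, C.d X ≤ tdistT (fine L (M (C.scale X)))
                (blockOf (L ^ C.scale X) (fine L (M (C.scale X))) (xA X))
                (blockOf (L ^ C.scale X) (fine L (M (C.scale X))) (yA X)))
            (T : Type)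
            (h k : (X : C.Dom) → (ℕ → ℝ) → C.BgA → Tor (fine L (M (C.scale X))) → ℝ)
            (hT kT : T → (X : C.Dom) → (ℕ → ℝ) → C.BgA → Tor (fine L (M (C.scale X))) → ℝ)
            (_hh : ∀ X g U z, |h X g U z| ≤ 1) (_hk : ∀ X g U w, |k X g U w| ≤ 1)
            (_hhT : ∀ t X g U z, |hT t X g U z| ≤ 1) (_hkT : ∀ t X g U w, |kT t X g U w| ≤ 1)
            (EA : Functional C C.BgA) (EB : Functional C C.BgB) (DA : T → Functional C C.BgA) (DB : T → Functional C C.BgB)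
            (_hEA : ∀ g U X, EA g U X =
              (fun z => minimiser (L ^ C.scale X) (fine L (M (C.scale X))) (aK a L (C.scale X))
                  (((L ^ C.scale X : ℕ) : ℝ) ^ 2) m2 (Pi.single z 1) (xA X) * h X g U z)
                ⬝ᵥ ((effLaplacian (L ^ C.scale X) (fine L (M (C.scale X))) (aK a L (C.scale X))
                        (((L ^ C.scale X : ℕ) : ℝ) ^ 2) m2
                      + (a * ((L : ℝ) ^ 2)⁻¹) • blockProj L (M (C.scale X)))⁻¹
                    *ᵥ fun w => k X g U w * minimiser (L ^ C.scale X) (fine L (M (C.scale X))) (aK a L (C.scale X))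
                        (((L ^ C.scale X : ℕ) : ℝ) ^ 2) m2 (Pi.single w 1) (yA X)))
            (_hEB : ∀ g U X, EB g U X =
              (fun z => minimiser (L ^ n * L ^ C.scale X) (fine L (M (C.scale X))) (aK a L (C.scale X + n))
                  (((L ^ n * L ^ C.scale X : ℕ) : ℝ) ^ 2) m2 (Pi.single z 1) (xB X) * h X g (C.transport U) z)
                ⬝ᵥ ((effLaplacian (L ^ n * L ^ C.scale X) (fine L (M (C.scale X))) (aK a L (C.scale X + n))
                        (((L ^ n * L ^ C.scale X : ℕ) : ℝ) ^ 2) m2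
                      + (a * ((L : ℝ) ^ 2)⁻¹) • blockProj L (M (C.scale X)))⁻¹
                    *ᵥ fun w => k X g (C.transport U) w * minimiser (L ^ n * L ^ C.scale X) (fine L (M (C.scale X)))
                        (aK a L (C.scale X + n)) (((L ^ n * L ^ C.scale X : ℕ) : ℝ) ^ 2) m2 (Pi.single w 1) (yB X)))
            (_hDA : ∀ t g U X, DA t g U X =
              (fun z => minimiser (L ^ C.scale X) (fine L (M (C.scale X))) (aK a L (C.scale X))
                  (((L ^ C.scale X : ℕ) : ℝ) ^ 2) m2 (Pi.single z 1) (xA X) * hT t X g U z)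
                ⬝ᵥ ((effLaplacian (L ^ C.scale X) (fine L (M (C.scale X))) (aK a L (C.scale X))
                        (((L ^ C.scale X : ℕ) : ℝ) ^ 2) m2
                      + (a * ((L : ℝ) ^ 2)⁻¹) • blockProj L (M (C.scale X)))⁻¹
                    *ᵥ fun w => kT t X g U w * minimiser (L ^ C.scale X) (fine L (M (C.scale X))) (aK a L (C.scale X))
                        (((L ^ C.scale X : ℕ) : ℝ) ^ 2) m2 (Pi.single w 1) (yA X)))
            (_hDB : ∀ t g U X, DB t g U X =
              (fun z => minimiser (L ^ n * L ^ C.scale X) (fine L (M (C.scale X))) (aK a L (C.scale X + n))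
                  (((L ^ n * L ^ C.scale X : ℕ) : ℝ) ^ 2) m2 (Pi.single z 1) (xB X) * hT t X g (C.transport U) z)
                ⬝ᵥ ((effLaplacian (L ^ n * L ^ C.scale X) (fine L (M (C.scale X))) (aK a L (C.scale X + n))
                        (((L ^ n * L ^ C.scale X : ℕ) : ℝ) ^ 2) m2
                      + (a * ((L : ℝ) ^ 2)⁻¹) • blockProj L (M (C.scale X)))⁻¹
                    *ᵥ fun w => kT t X g (C.transport U) w * minimiser (L ^ n * L ^ C.scale X) (fine L (M (C.scale X)))
                        (aK a L (C.scale X + n)) (((L ^ n * L ^ C.scale X : ℕ) : ℝ) ^ 2) m2 (Pi.single w 1) (yB X)))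
            (C₉ ω cr ρ : ℝ),
            (𝔯.lit F θ hP g₀ os).u3 =
              U3Objects₁₁.ofFixed
                { C with
                  Dom := C.Dom ⊕ (C.Dom × T)
                  scale := Sum.elim C.scale fun p => C.scale p.1
                  d := Sum.elim C.d fun p => C.d p.1
                  d_nonneg := Sum.rec (fun X => C.d_nonneg X) fun p => C.d_nonneg p.1 }
                (fun g U X => Sum.elim (EA g U) (fun p => DA p.2 g U p.1) X)
                (fun (_ : ℝ) g U X => Sum.elim (EB g U) (fun p => DB p.2 g U p.1) X)
                ⟨κ, (L : ℝ) ^ (-(γ / 2)), C₅, C₉, ω, cr, ρ⟩) →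
        S_N18 (RRec₁₃CoPH 𝔯) := by
  obtain ⟨κ, C₅, hκ, hC₅, H⟩ := n18At_dressed_kingModel_vertex_torus hd L hLp ha hm hγ0 hγ1
  refine ⟨κ, C₅, hκ, hC₅, ?_⟩
  intro N _ 𝔯 hpin
  refine s_N18_rRec₁₃CoPH_of_ofFixed 𝔯 fun F θ hP hA g₀ os => ?_
  obtain ⟨n, hn, M, hMz, hM, C, hsc, xA, yA, xB, yB, hx, hy, hdd, T, h, k, hT, kT, hh, hk, hhT, hkT, EA, EB, DA, DB, hEA, hEB, hDA, hDB,
    C₉, ω, cr, ρ, hu⟩ := hpin F θ hP hA g₀ os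
  refine ⟨_, _, _, ⟨κ, (L : ℝ) ^ (-(γ / 2)), C₅, C₉, ω, cr, ρ⟩, hu, fun b hb _ => ?_⟩
  exact H n hn M hM C hsc xA yA xB yB hx hy hdd h k hT kT hh hk hhT hkT EA EB DA DB hEA hEB hDA hDB (Window θ.γ) b (fun _ _ => 0) C₉ ω cr ρ
    b hb le_rfl

end Summit.QuantumFields.YangMills.BalabanUVNodes.N18KingModelVertexRecordWindow

end
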